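import Literature.Dynamics.Homogeneous.OrthogonalGroupOrbitClosuresFixedSpaces
import Literature.Dynamics.Homogeneous.OrthogonalGroupOrbitClosuresProofs
import HarnessLib

/-!
# Rational commutants and the exclusion of `SO(P^⊥)·SO(P)` in Verbitsky's orbit-closure
# trichotomy (erratum §2.3): eigenvalues of large multiplicity, integer commutants, `±1` on a
# plane with a rational line

Topic `Literature/Dynamics/Homogeneous`; theorems only (no new notion, no named fact — D-0026), on
top of `OrthogonalGroupOrbitClosuresFixedSpaces` (fixed spaces of integer matrices are rational;
the plane `P_x` of a K3 period vector) and `OrthogonalGroupOrbitClosuresProofs` (integral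
isometries of `Λ_{K3}`). In the Ratner-theoretic proof of
`Literature.Dynamics.Homogeneous.Verbitsky2017_orbitClosure_trichotomy_K3`
[Verbitsky2017ErgodicErratum, §2.3] the fourth candidate for the Ratner group of a frame with plane
`P = P_x`, namely `S = SO(P^⊥)°·SO(P)` (Lie algebra `𝔰𝔬(V₀) ⊕ 𝔰𝔬(V₁)` of the erratum §2.1
classification, `…Subalgebras`), must be excluded for irrational planes; the erratum's one-line
reason ("impossible, because `S` is generated by unipotents") is loose, and the honest argument is
Borel density [Morris2005Ratner, Prop. 4.7.1] for the lattice `Δ = Γ ∩ S` of INTEGER matrices: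
the commutant of `Δ` lies in that of the unipotents of `S`, i.e. (`k3_forall_commute_isotropicWedge_iff`,
`SkewPlane.commute_unipotent_iff`) in "scalars on `P^⊥` ⊕ `End P`", while it contains the
rotation `J` of `P`. This file proves the arithmetic that turns this into a contradiction, plus
the companion used in case (iii):

* `rank_map_ringHom` — the rank of a square matrix over a field is invariant under entrywise
  application of a field homomorphism (via Mathlib's rank normal form
  `Matrix.exists_rank_normal_form`);
* `exists_ratCast_eq_of_lt_two_mul_finrank_ker` — **an eigenvalue of a rational `n × n` matrix
  whose real eigenspace has dimension `> n/2` is rational**: otherwise a Galois conjugate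
  `β ≠ α` (a second complex root of the minimal polynomial) has a complex eigenspace of the same
  dimension (`C − α`, `C − β` are the images of `C − x ∈ M_n(ℚ[x]/(f))` under two embeddings;
  ranks agree), and distinct eigenspaces are independent;
* `mem_span_intCommutant_of_forall_commute` — the real commutant of any family of integer matrices
  is spanned by its INTEGER points (it is the fixed space of the integer maps `X ↦ X + Xg − gX`;
  `mem_span_latticeFixed_of_forall_mulVec_eq`);
* `k3_exists_latticeVector_inPlane_of_commutant` — **the exclusion**: if every real matrix commuting
  with `Δ` is a scalar on `P_x^⊥` and preserves `P_x`, and some non-scalar real matrix commutes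
  with `Δ`, then `P_x` contains a non-zero lattice vector (a non-scalar integer `Z` in the
  commutant has a rational `P_x^⊥`-eigenvalue `α` of multiplicity `20 > 11`, and the columns of
  the rational matrix `Z − α ≠ 0` are rational vectors of `P_x`) — contradicting case (ii);
* `k3_isRationalPlane_of_two_latticeVectors`, `k3_frame_fixed_up_to_sign_of_rotation` — in case
  (iii) (`P_x ∋ v ≠ 0` lattice, `P_x` not rational) an integral isometry rotating the frame
  (`δ Re x = c Re x + s Im x`, `δ Im x = −s Re x + c Im x`) has `s = 0`, `c = ±1`; so the
  frame-fixing subgroup of `Γ ∩ S` has index `≤ 2` and fixed space `⊇ P_x`, and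
  `k3_isRationalPlane_of_fixedSpace_eq_plane` applies to it.

Not here (not in Mathlib): Ratner's theorem, Borel–Harish-Chandra, Borel density, the Lie
correspondence; see the module docstring of `OrthogonalGroupOrbitClosuresProofs` for the assembly
`Verbitsky2017_orbitClosure_trichotomy_K3_of_frameOrbitClosure`.

## References

* [Verbitsky2017ErgodicErratum] M. Verbitsky, Ergodic complex structures on hyperkähler manifolds:
  an erratum, arXiv:1708.05802 (2017), §2.3 (proof of the Theorem: "`S` is either `SO⁺(a−2,b)`,
  `SO⁺(a−1,b)`, `SO⁺(a,b)` or `SO⁺(a−2,b) × SO(2)`; however, the later case is impossible"),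
  §2.1, §2.2.
* [Morris2005Ratner] D. W. Morris, Ratner's Theorems on Unipotent Flows, Univ. of Chicago Press
  2005, Prop. 4.7.1 (Borel density theorem), Rem. 1.1.19.
-/

noncomputable section

namespace Literature.Dynamics.Homogeneous

open Module Polynomial
open scoped Matrix
open Literature.AlgebraicGeometry Literature.AlgebraicGeometry.Surfaces
open Literature.Algebra.EuclideanLattices

/-! ### Rank is invariant under field homomorphisms -/

section RankMap

open Matrix

variable {m : Type*} [Fintype m] [DecidableEq m]

/-- The rank of the normal form `fromBlocks 1 0 0 0` is the size of its identity block. [folklore] -/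
theorem rank_fromBlocks_one_zero {L : Type*} [Field L] (r s : ℕ) :
    (fromBlocks 1 0 0 0 : Matrix (Fin r ⊕ Fin s) (Fin r ⊕ Fin s) L).rank = r := by
  classical
  rw [← diagonal_one, ← diagonal_zero, fromBlocks_diagonal, rank_diagonal, Fintype.card_subtype]
  have : (Finset.univ.filter fun i : Fin r ⊕ Fin s =>
      Sum.elim (fun _ => (1 : L)) (fun _ => 0) i ≠ 0) =
      (Finset.univ : Finset (Fin r)).map Function.Embedding.inl := by
    ext i
    cases i <;> simp
  rw [this, Finset.card_map, Finset.card_univ, Fintype.card_fin]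

/-- **The rank of a square matrix is invariant under entrywise application of a field
homomorphism** (rank normal form `V M U = 1 ⊕ 0` is preserved). [folklore] -/
theorem rank_map_ringHom {K L : Type*} [Field K] [Field L] (φ : K →+* L) (M : Matrix m m K) :
    (M.map φ).rank = M.rank := by
  classical
  obtain ⟨V, U, e, hV, hU, hVMU⟩ := Matrix.exists_rank_normal_form M
  have hVd : IsUnit (V.map φ).det := by
    rw [← RingHom.mapMatrix_apply, ← RingHom.map_det]
    exact ((Matrix.isUnit_iff_isUnit_det V).1 hV).map φ
  have hUd : IsUnit (U.map φ).det := by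
    rw [← RingHom.mapMatrix_apply, ← RingHom.map_det]
    exact ((Matrix.isUnit_iff_isUnit_det U).1 hU).map φ
  have h1 : (V.map φ * M.map φ * U.map φ).rank = (M.map φ).rank := by
    rw [rank_mul_eq_left_of_isUnit_det (U.map φ) _ hUd,
      rank_mul_eq_right_of_isUnit_det (V.map φ) _ hVd]
  have h2 : V.map φ * M.map φ * U.map φ =
      (fromBlocks 1 0 0 0 : Matrix _ _ L).submatrix e e := by
    rw [← Matrix.map_mul, ← Matrix.map_mul, hVMU, ← Matrix.submatrix_map, Matrix.fromBlocks_map,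
      Matrix.map_one φ (map_zero φ) (map_one φ), Matrix.map_zero φ (map_zero φ),
      Matrix.map_zero φ (map_zero φ), Matrix.map_zero φ (map_zero φ)]
  rw [← h1, h2, rank_submatrix, rank_fromBlocks_one_zero]

end RankMap

/-! ### Eigenvalues of rational matrices of large geometric multiplicity are rational -/

section Multiplicity

open Matrix

variable {m : Type*} [Fintype m] [DecidableEq m]

/-- `(C − a·1) v = 0 ↔ C v = a v`. [folklore] -/
theorem mulVecLin_sub_scalar_eq_zero_iff {L : Type*} [Field L] (C : Matrix m m L) (a : L)
    (v : m → L) : Matrix.mulVecLin (C - Matrix.scalar m a) v = 0 ↔ C *ᵥ v = a • v := by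
  rw [Matrix.mulVecLin_apply, Matrix.sub_mulVec, sub_eq_zero]
  have : Matrix.scalar m a *ᵥ v = a • v := by
    ext i; simp [Matrix.scalar_apply, Matrix.mulVec_diagonal]
  rw [this]

/-- Kernels of `C − α` and `C − β` meet trivially for `α ≠ β`. [folklore] -/
theorem disjoint_ker_sub_scalar {L : Type*} [Field L] (C : Matrix m m L) {α β : L} (hαβ : α ≠ β) :
    Disjoint (LinearMap.ker (Matrix.mulVecLin (C - Matrix.scalar m α)))
      (LinearMap.ker (Matrix.mulVecLin (C - Matrix.scalar m β))) := by
  rw [Submodule.disjoint_def]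
  intro v hvα hvβ
  rw [LinearMap.mem_ker, mulVecLin_sub_scalar_eq_zero_iff] at hvα hvβ
  have h : (α - β) • v = 0 := by rw [sub_smul, ← hvα, ← hvβ, sub_self]
  exact (smul_eq_zero.1 h).resolve_left (sub_ne_zero.2 hαβ)

omit [DecidableEq m] in
/-- `dim ker + rank = n` for a square matrix over a field. [folklore] -/
theorem finrank_ker_add_rank {L : Type*} [Field L] (M : Matrix m m L) :
    finrank L (LinearMap.ker (Matrix.mulVecLin M)) + M.rank = Fintype.card m := by
  rw [Matrix.rank, add_comm, LinearMap.finrank_range_add_finrank_ker, finrank_fintype_fun_eq_card]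

/-- **An eigenvalue of a rational matrix whose eigenspace has dimension `> n/2` is rational.**
If `C ∈ M_n(ℚ)` and the real eigenspace `ker (C − α)` (`α ∈ ℝ`) has dimension `k` with
`2k > n`, then `α ∈ ℚ`: otherwise `α` has a Galois conjugate `β ≠ α` in `ℂ` (a second root of its
minimal polynomial), the two complex eigenspaces `ker (C − α)`, `ker (C − β)` have the same
dimension `k` (both `C − α·1`, `C − β·1` are images of `C − x·1 ∈ M_n(ℚ[x]/(f))` under field
embeddings, and rank is invariant, `rank_map_ringHom`) and are independent: `2k ≤ n`. [folklore] -/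
theorem exists_ratCast_eq_of_lt_two_mul_finrank_ker (C : Matrix m m ℚ) (α : ℝ)
    (h : Fintype.card m < 2 * finrank ℝ (LinearMap.ker (Matrix.mulVecLin
      (C.map (algebraMap ℚ ℝ) - Matrix.scalar m α)))) :
    ∃ q : ℚ, (q : ℝ) = α := by
  classical
  by_contra hα
  set k := finrank ℝ (LinearMap.ker (Matrix.mulVecLin (C.map (algebraMap ℚ ℝ) - Matrix.scalar m α)))
    with hk
  have hk0 : 0 < k := by omega
  -- `α` is a root of the characteristic polynomial, hence integral over `ℚ`
  have hdet : (C.map (algebraMap ℚ ℝ) - Matrix.scalar m α).det = 0 := by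
    have hne : LinearMap.ker (Matrix.mulVecLin (C.map (algebraMap ℚ ℝ) - Matrix.scalar m α)) ≠ ⊥ := by
      intro hbot
      rw [hk, hbot, finrank_bot] at hk0
      exact lt_irrefl _ hk0
    obtain ⟨v, hv, hv0⟩ := (Submodule.ne_bot_iff _).1 hne
    rw [LinearMap.mem_ker, Matrix.mulVecLin_apply] at hv
    exact (Matrix.exists_mulVec_eq_zero_iff).1 ⟨v, hv0, hv⟩
  have hint : IsIntegral ℚ α := by
    refine ⟨C.charpoly, Matrix.charpoly_monic C, ?_⟩
    rw [← Polynomial.eval_map, ← Matrix.charpoly_map, Matrix.eval_charpoly]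
    have : Matrix.scalar m α - C.map (algebraMap ℚ ℝ) = -(C.map (algebraMap ℚ ℝ) - Matrix.scalar m α) := by
      abel
    rw [this, Matrix.det_neg, hdet, mul_zero]
  set f := minpoly ℚ α with hf
  have hfirr : Irreducible f := minpoly.irreducible hint
  have hd : 2 ≤ f.natDegree := by
    refine (minpoly.two_le_natDegree_iff hint).2 ?_
    rintro ⟨q, hq⟩
    exact hα ⟨q, by rw [← hq]; rfl⟩
  -- a second complex root `β ≠ α`
  have hsep : f.Separable := hfirr.separable
  have hcard : Fintype.card (f.rootSet ℂ) = f.natDegree :=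
    card_rootSet_eq_natDegree hsep (IsAlgClosed.splits _)
  have hαC : f.eval₂ (algebraMap ℚ ℂ) (α : ℂ) = 0 := by
    have h1 : aeval α f = 0 := minpoly.aeval ℚ α
    have h2 := congr_arg (algebraMap ℝ ℂ) h1
    rw [map_zero, aeval_def, Polynomial.hom_eval₂] at h2
    have hcomp : (algebraMap ℝ ℂ).comp (algebraMap ℚ ℝ) = algebraMap ℚ ℂ := by
      ext q; simp
    rwa [hcomp] at h2
  have hαmem : ((α : ℂ)) ∈ f.rootSet ℂ := by
    rw [mem_rootSet]
    exact ⟨minpoly.ne_zero hint, by rwa [aeval_def]⟩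
  have hlt : 1 < Fintype.card (f.rootSet ℂ) := by rw [hcard]; omega
  obtain ⟨⟨β, hβmem⟩, hβne⟩ := Fintype.exists_ne_of_one_lt_card hlt ⟨(α : ℂ), hαmem⟩
  have hβα : β ≠ (α : ℂ) := fun h => hβne (Subtype.ext h)
  have hβC : f.eval₂ (algebraMap ℚ ℂ) β = 0 := by
    have := (mem_rootSet.1 hβmem).2
    rwa [aeval_def] at this
  -- the field `F = ℚ[x]/(f)` and its two embeddings
  haveI : Fact (Irreducible f) := ⟨hfirr⟩
  set φα : AdjoinRoot f →+* ℂ := AdjoinRoot.lift (algebraMap ℚ ℂ) (α : ℂ) hαC with hφα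
  set φβ : AdjoinRoot f →+* ℂ := AdjoinRoot.lift (algebraMap ℚ ℂ) β hβC with hφβ
  set MF : Matrix m m (AdjoinRoot f) :=
    C.map (AdjoinRoot.of f) - Matrix.scalar m (AdjoinRoot.root f) with hMF
  have hmapα : MF.map φα = C.map (algebraMap ℚ ℂ) - Matrix.scalar m (α : ℂ) := by
    ext i j
    simp only [hMF, hφα, Matrix.map_apply, Matrix.sub_apply, Matrix.scalar_apply,
      Matrix.diagonal_apply, map_sub, AdjoinRoot.lift_of]
    split_ifs <;> simp
  have hmapβ : MF.map φβ = C.map (algebraMap ℚ ℂ) - Matrix.scalar m β := by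
    ext i j
    simp only [hMF, hφβ, Matrix.map_apply, Matrix.sub_apply, Matrix.scalar_apply,
      Matrix.diagonal_apply, map_sub, AdjoinRoot.lift_of]
    split_ifs <;> simp
  have hmapR : (C.map (algebraMap ℚ ℝ) - Matrix.scalar m α).map (algebraMap ℝ ℂ) =
      C.map (algebraMap ℚ ℂ) - Matrix.scalar m (α : ℂ) := by
    ext i j
    simp only [Matrix.map_apply, Matrix.sub_apply, Matrix.scalar_apply, Matrix.diagonal_apply,
      map_sub]
    split_ifs <;> simp
  -- equal ranks
  have hrα : (C.map (algebraMap ℚ ℂ) - Matrix.scalar m (α : ℂ)).rank = MF.rank := by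
    rw [← hmapα, rank_map_ringHom]
  have hrβ : (C.map (algebraMap ℚ ℂ) - Matrix.scalar m β).rank = MF.rank := by
    rw [← hmapβ, rank_map_ringHom]
  have hrR : (C.map (algebraMap ℚ ℂ) - Matrix.scalar m (α : ℂ)).rank =
      (C.map (algebraMap ℚ ℝ) - Matrix.scalar m α).rank := by
    rw [← hmapR, rank_map_ringHom]
  -- kernel dimensions
  have hkR := finrank_ker_add_rank (C.map (algebraMap ℚ ℝ) - Matrix.scalar m α)
  have hkα := finrank_ker_add_rank (C.map (algebraMap ℚ ℂ) - Matrix.scalar m (α : ℂ))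
  have hkβ := finrank_ker_add_rank (C.map (algebraMap ℚ ℂ) - Matrix.scalar m β)
  set Kα := LinearMap.ker (Matrix.mulVecLin (C.map (algebraMap ℚ ℂ) - Matrix.scalar m (α : ℂ)))
  set Kβ := LinearMap.ker (Matrix.mulVecLin (C.map (algebraMap ℚ ℂ) - Matrix.scalar m β))
  have hKα : finrank ℂ Kα = k := by omega
  have hKβ : finrank ℂ Kβ = k := by omega
  -- independence of the two eigenspaces
  have hdisj : Kα ⊓ Kβ = ⊥ := (disjoint_ker_sub_scalar _ hβα.symm).eq_bot
  have hdim := Submodule.finrank_sup_add_finrank_inf_eq Kα Kβ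
  rw [hdisj, finrank_bot, add_zero, hKα, hKβ] at hdim
  have hle : finrank ℂ ↥(Kα ⊔ Kβ) ≤ Fintype.card m := by
    have := Submodule.finrank_le (Kα ⊔ Kβ)
    rwa [finrank_fintype_fun_eq_card] at this
  omega

end Multiplicity


/-! ### The commutant of a family of integer matrices is spanned by integer matrices -/

section Commutant

variable {n : Type*} [Fintype n] [DecidableEq n]

/-- The integer "commutator-shift" matrix of `g` on `n × n`-indexed vectors: flattening
`X ↦ X + (X g − g X)`. [folklore] -/
theorem commShift_mulVec (g : Matrix n n ℤ) (X : Matrix n n ℝ) (i j : n) :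
    ((Matrix.of fun (p q : n × n) =>
        ((if p.1 = q.1 ∧ p.2 = q.2 then 1 else 0) + (if p.1 = q.1 then g q.2 p.2 else 0) -
          (if q.2 = p.2 then g p.1 q.1 else 0) : ℤ)).map (Int.cast : ℤ → ℝ) *ᵥ
        (fun q : n × n => X q.1 q.2)) (i, j) =
      X i j + (X * g.map (Int.cast : ℤ → ℝ) - g.map (Int.cast : ℤ → ℝ) * X) i j := by
  simp only [Matrix.mulVec, dotProduct, Matrix.map_apply, Matrix.of_apply, Int.cast_sub,
    Int.cast_add, Int.cast_ite, Int.cast_one, Int.cast_zero, Fintype.sum_prod_type, sub_mul,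
    add_mul, ite_mul, one_mul, zero_mul, Finset.sum_add_distrib, Finset.sum_sub_distrib,
    Matrix.sub_apply, Matrix.mul_apply]
  have h1 : ∑ x : n, ∑ y : n, (if i = x ∧ j = y then X x y else 0) = X i j := by
    rw [Finset.sum_eq_single i]
    · rw [Finset.sum_eq_single j]
      · simp
      · intro y _ hy; simp [Ne.symm hy]
      · simp
    · intro x _ hx; simp [Ne.symm hx]
    · simp
  have h2 : ∑ x : n, ∑ y : n, (if i = x then (g y j : ℝ) * X x y else 0) =
      ∑ y, X i y * (g y j : ℝ) := by
    rw [Finset.sum_eq_single i]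
    · simp [mul_comm]
    · intro x _ hx; simp [Ne.symm hx]
    · simp
  have h3 : ∑ x : n, ∑ y : n, (if y = j then (g i x : ℝ) * X x y else 0) =
      ∑ x, (g i x : ℝ) * X x j := by
    refine Finset.sum_congr rfl fun x _ => ?_
    rw [Finset.sum_eq_single j]
    · simp
    · intro y _ hy; simp [hy]
    · simp
  rw [h1, h2, h3]
  ring

/-- **The real commutant of a family of integer matrices is spanned by its integer points**: a
real matrix commuting with every `g ∈ Δ ⊆ M_n(ℤ)` is a real linear combination of INTEGER
matrices commuting with every `g ∈ Δ` (the commutant is the fixed space of the integer maps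
`X ↦ X + (Xg − gX)`; `mem_span_latticeFixed_of_forall_mulVec_eq`). [folklore] -/
theorem mem_span_intCommutant_of_forall_commute (Δ : Set (Matrix n n ℤ)) {X : Matrix n n ℝ}
    (hX : ∀ g ∈ Δ, X * g.map (Int.cast : ℤ → ℝ) = g.map (Int.cast : ℤ → ℝ) * X) :
    X ∈ Submodule.span ℝ {Y : Matrix n n ℝ | ∃ Z : Matrix n n ℤ,
      (∀ g ∈ Δ, Z * g = g * Z) ∧ Y = Z.map (Int.cast : ℤ → ℝ)} := by
  classical
  -- the flattened problem
  let T : Matrix n n ℤ → Matrix (n × n) (n × n) ℤ := fun g => Matrix.of fun (p q : n × n) =>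
    ((if p.1 = q.1 ∧ p.2 = q.2 then 1 else 0) + (if p.1 = q.1 then g q.2 p.2 else 0) -
      (if q.2 = p.2 then g p.1 q.1 else 0) : ℤ)
  let fl : Matrix n n ℝ →ₗ[ℝ] (n × n → ℝ) :=
    { toFun := fun Y q => Y q.1 q.2
      map_add' := fun _ _ => rfl
      map_smul' := fun _ _ => rfl }
  let ufl : (n × n → ℝ) →ₗ[ℝ] Matrix n n ℝ :=
    { toFun := fun y => Matrix.of fun i j => y (i, j)
      map_add' := fun _ _ => rfl
      map_smul' := fun _ _ => rfl }
  have hufl : ∀ Y : Matrix n n ℝ, ufl (fl Y) = Y := fun Y => by ext i j; rfl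
  -- `fl X` is fixed by all `T g`
  have hfix : ∀ G ∈ T '' Δ, (G.map (Int.cast : ℤ → ℝ)) *ᵥ fl X = fl X := by
    rintro _ ⟨g, hg, rfl⟩
    funext q
    obtain ⟨i, j⟩ := q
    have := commShift_mulVec g X i j
    rw [hX g hg, sub_self, Matrix.zero_apply, add_zero] at this
    exact this
  have hmem := mem_span_latticeFixed_of_forall_mulVec_eq (T '' Δ) hfix
  -- transport back along `ufl`
  have hmap := Submodule.mem_map_of_mem (f := ufl) hmem
  rw [hufl, Submodule.map_span] at hmap
  refine (Submodule.span_mono ?_) hmap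
  rintro _ ⟨_, ⟨v, hv, rfl⟩, rfl⟩
  refine ⟨Matrix.of fun i j => v (i, j), fun g hg => ?_, ?_⟩
  · -- integrality: `Z g = g Z` from `T g v = v`
    have h := hv (T g) ⟨g, hg, rfl⟩
    set VR : Matrix n n ℝ := Matrix.of fun i j => (v (i, j) : ℝ) with hVR
    have hv'' : ((T g).map (Int.cast : ℤ → ℝ)) *ᵥ (fun q : n × n => VR q.1 q.2) =
        fun q => VR q.1 q.2 := by
      funext q
      have hq := congrFun h q
      simp only [Matrix.mulVec, dotProduct] at hq
      have hqR : (∑ r, ((T g q r : ℤ) : ℝ) * (v r : ℝ)) = (v q : ℝ) := by exact_mod_cast hq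
      simp only [Matrix.mulVec, dotProduct, Matrix.map_apply, hVR, Matrix.of_apply, Prod.mk.eta]
      exact hqR
    have hR : ∀ i j, (VR * g.map (Int.cast : ℤ → ℝ) - g.map (Int.cast : ℤ → ℝ) * VR) i j = 0 := by
      intro i j
      have hc := commShift_mulVec g VR i j
      rw [hv''] at hc
      linarith
    ext i j
    have h0 := hR i j
    simp only [hVR, Matrix.sub_apply, Matrix.mul_apply, Matrix.of_apply, Matrix.map_apply] at h0
    simp only [Matrix.mul_apply, Matrix.of_apply]
    exact_mod_cast (sub_eq_zero.1 h0)
  · ext i j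
    rfl

end Commutant

/-! ### Exclusion of the Ratner group `SO(P_x^⊥)°·SO(P_x)`: a non-scalar commutant forces a
lattice vector in the plane -/

section K3Commutant

/-- **A non-scalar commutant forces a lattice vector in the plane.** Let `x ∈ D`, `P_x` its plane,
and `Δ` a family of integer matrices such that every real matrix commuting with `Δ` is a scalar
on `P_x^⊥` and preserves `P_x` (for `Δ = Γ ∩ S` a lattice in a Ratner group `S ⊇ H = SO(P_x^⊥)°`
this is Borel density, Morris Prop. 4.7.1, combined with `k3_forall_commute_isotropicWedge_iff` and
`SkewPlane.commute_unipotent_iff`). If some NON-SCALAR real matrix commutes with `Δ` (for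
`S = SO(P_x^⊥)°·SO(P_x)`: the rotation by `π/2` of `P_x` extended by `0`), then `P_x` contains a
non-zero lattice vector — so `x` is not in the totally irrational case (ii) of
`Verbitsky2017_orbitClosure_trichotomy_K3`. Proof: the commutant is spanned by integer matrices
(`mem_span_intCommutant_of_forall_commute`), so it contains a non-scalar INTEGER `Z`; its
`P_x^⊥`-eigenvalue `α` has multiplicity `≥ 20 > 22/2`, hence is rational
(`exists_ratCast_eq_of_lt_two_mul_finrank_ker`); then `Z − α` is a non-zero rational matrix
killing `P_x^⊥` and mapping `P_x` into itself, so its columns are rational vectors of `P_x`, one of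
them non-zero. [folklore] [cite: Verbitsky2017ErgodicErratum, §2.3 (proof: "`SO⁺(a−2,b) × SO(2)` … is impossible")] -/
theorem k3_exists_latticeVector_inPlane_of_commutant {x : K3Index → ℂ} (hx : x ∈ k3PeriodDomain)
    (Δ : Set (Matrix K3Index K3Index ℤ))
    (hcomm : ∀ X : Matrix K3Index K3Index ℝ,
      (∀ g ∈ Δ, X * g.map (Int.cast : ℤ → ℝ) = g.map (Int.cast : ℤ → ℝ) * X) →
      (∃ α : ℝ, ∀ v ∈ (Matrix.toBilin' (k3Gram.map (Int.cast : ℤ → ℝ))).orthogonal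
          (Submodule.span ℝ (Set.range ![fun i => (x i).re, fun i => (x i).im])),
          X *ᵥ v = α • v) ∧
      (∀ e ∈ Submodule.span ℝ (Set.range ![fun i => (x i).re, fun i => (x i).im]),
          X *ᵥ e ∈ Submodule.span ℝ (Set.range ![fun i => (x i).re, fun i => (x i).im])))
    {X₀ : Matrix K3Index K3Index ℝ}
    (hX₀ : ∀ g ∈ Δ, X₀ * g.map (Int.cast : ℤ → ℝ) = g.map (Int.cast : ℤ → ℝ) * X₀)
    (hX₀' : ∀ c : ℝ, X₀ ≠ c • (1 : Matrix K3Index K3Index ℝ)) :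
    ∃ v : K3Index → ℤ, v ≠ 0 ∧ ∃ a b : ℝ, ∀ i, (v i : ℝ) = a * (x i).re + b * (x i).im := by
  classical
  set B := Matrix.toBilin' (k3Gram.map (Int.cast : ℤ → ℝ)) with hB
  set P : Submodule ℝ (K3Index → ℝ) :=
    Submodule.span ℝ (Set.range ![fun i => (x i).re, fun i => (x i).im]) with hP
  -- Step 1: a non-scalar INTEGER matrix commuting with `Δ`
  obtain ⟨Z, hZ, hZns⟩ : ∃ Z : Matrix K3Index K3Index ℤ, (∀ g ∈ Δ, Z * g = g * Z) ∧
      ∀ c : ℝ, Z.map (Int.cast : ℤ → ℝ) ≠ c • 1 := by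
    by_contra hcon
    have hcon' : ∀ Z : Matrix K3Index K3Index ℤ, (∀ g ∈ Δ, Z * g = g * Z) →
        ∃ c : ℝ, Z.map (Int.cast : ℤ → ℝ) = c • 1 := fun Z hZ => by
      by_contra h'
      exact hcon ⟨Z, hZ, fun c hc => h' ⟨c, hc⟩⟩
    have hspan := mem_span_intCommutant_of_forall_commute Δ hX₀
    have hle : Submodule.span ℝ {Y : Matrix K3Index K3Index ℝ | ∃ Z : Matrix K3Index K3Index ℤ,
        (∀ g ∈ Δ, Z * g = g * Z) ∧ Y = Z.map (Int.cast : ℤ → ℝ)} ≤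
        Submodule.span ℝ {(1 : Matrix K3Index K3Index ℝ)} := by
      refine Submodule.span_le.2 ?_
      rintro _ ⟨Z, hZ, rfl⟩
      obtain ⟨c, hc⟩ := hcon' Z hZ
      rw [SetLike.mem_coe, hc]
      exact Submodule.smul_mem _ _ (Submodule.subset_span rfl)
    obtain ⟨c, hc⟩ := Submodule.mem_span_singleton.1 (hle hspan)
    exact hX₀' c hc.symm
  -- Step 2: the structure of `Z` over `ℝ`
  set ZR : Matrix K3Index K3Index ℝ := Z.map (Int.cast : ℤ → ℝ) with hZR
  have hZRc : ∀ g ∈ Δ, ZR * g.map (Int.cast : ℤ → ℝ) = g.map (Int.cast : ℤ → ℝ) * ZR := by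
    intro g hg
    rw [hZR, ← Matrix.map_mul_intCast, ← Matrix.map_mul_intCast, hZ g hg]
  obtain ⟨⟨α, hα⟩, hZP⟩ := hcomm ZR hZRc
  -- Step 3: `α` is rational (multiplicity `20 > 11`)
  set C : Matrix K3Index K3Index ℚ := Z.map (Int.cast : ℤ → ℚ) with hC
  have hCR : C.map (algebraMap ℚ ℝ) = ZR := by
    ext i j
    simp [hC, hZR, Matrix.map_apply]
  have hker : B.orthogonal P ≤ LinearMap.ker (Matrix.mulVecLin (C.map (algebraMap ℚ ℝ) -
      Matrix.scalar K3Index α)) := fun v hv => by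
    rw [LinearMap.mem_ker, mulVecLin_sub_scalar_eq_zero_iff, hCR]
    exact hα v hv
  have h20 : finrank ℝ (B.orthogonal P) = 20 := by
    rw [LinearMap.BilinForm.finrank_orthogonal k3RForm_nondegenerate, hP, finrank_k3Plane hx,
      Module.finrank_fintype_fun_eq_card]
    simp [Fintype.card_sum, Fintype.card_fin]
  have hlt : Fintype.card K3Index < 2 * finrank ℝ (LinearMap.ker (Matrix.mulVecLin
      (C.map (algebraMap ℚ ℝ) - Matrix.scalar K3Index α))) := by
    have := Submodule.finrank_mono hker
    rw [h20] at this
    have hc : Fintype.card K3Index = 22 := by simp [Fintype.card_sum, Fintype.card_fin]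
    omega
  obtain ⟨q, hq⟩ := exists_ratCast_eq_of_lt_two_mul_finrank_ker C α hlt
  -- Step 4: `N = Z − q` is a non-zero rational matrix with columns in `P`
  set Nq : Matrix K3Index K3Index ℚ := C - Matrix.scalar K3Index q with hNq
  set NR : Matrix K3Index K3Index ℝ := Nq.map (Rat.cast : ℚ → ℝ) with hNR
  have hNR' : NR = ZR - Matrix.scalar K3Index α := by
    ext i j
    simp only [hNR, hNq, hC, hZR, Matrix.map_apply, Matrix.sub_apply, Matrix.scalar_apply,
      Matrix.diagonal_apply, Rat.cast_sub]
    split_ifs <;> simp [hq]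
  have hNv : ∀ v ∈ B.orthogonal P, NR *ᵥ v = 0 := fun v hv => by
    rw [hNR', Matrix.sub_mulVec, hα v hv, sub_eq_zero, Matrix.scalar_apply]
    ext i; simp [Matrix.mulVec_diagonal]
  have hNe : ∀ e ∈ P, NR *ᵥ e ∈ P := fun e he => by
    rw [hNR', Matrix.sub_mulVec, Matrix.scalar_apply]
    have : (Matrix.diagonal fun _ : K3Index => α) *ᵥ e = α • e := by
      ext i; simp [Matrix.mulVec_diagonal]
    rw [this]
    exact Submodule.sub_mem _ (hZP e he) (Submodule.smul_mem _ _ he)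
  have hc : IsCompl P (B.orthogonal P) :=
    SkewPlane.isCompl_orthogonal_of_anisotropic isSymm_k3RForm (k3Plane_anisotropic hx)
  have hNall : ∀ y, NR *ᵥ y ∈ P := fun y => by
    have hy : y ∈ P ⊔ B.orthogonal P := by rw [hc.sup_eq_top]; exact Submodule.mem_top
    obtain ⟨e, he, v, hv, rfl⟩ := Submodule.mem_sup.1 hy
    rw [Matrix.mulVec_add, hNv v hv, add_zero]
    exact hNe e he
  have hNq0 : Nq ≠ 0 := by
    intro h0
    apply hZns α
    have : NR = 0 := by rw [hNR, h0]; ext i j; simp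
    rw [hNR', sub_eq_zero] at this
    rw [this, Matrix.scalar_apply, ← Matrix.smul_one_eq_diagonal]
  -- the integer matrix `W = den • Nq` and a non-zero column of it
  set W : Matrix K3Index K3Index ℤ := Nq.num with hW
  have hW0 : W ≠ 0 := fun h => hNq0 ((Matrix.num_eq_zero_iff Nq).1 h)
  obtain ⟨i₀, j₀, hij⟩ : ∃ i j, W i j ≠ 0 := by
    by_contra hcon
    apply hW0
    ext i j
    by_contra h
    exact hcon ⟨i, j, h⟩
  have hWq : ∀ i j, (W i j : ℚ) = Nq.den * Nq i j := fun i j => by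
    have h := Matrix.num_div_den Nq i j
    rw [div_eq_iff (Nat.cast_ne_zero.2 Nq.den_ne_zero)] at h
    rw [hW, h, mul_comm]
  have hcol : (fun i => (W i j₀ : ℝ)) = (Nq.den : ℝ) • (NR *ᵥ Pi.single j₀ 1) := by
    funext i
    have h1 : (NR *ᵥ Pi.single j₀ (1 : ℝ)) i = NR i j₀ := by
      simp [Matrix.mulVec, dotProduct, Pi.single_apply]
    have h2 : ((W i j₀ : ℤ) : ℝ) = (Nq.den : ℝ) * ((Nq i j₀ : ℚ) : ℝ) := by
      have h3 := congr_arg (Rat.cast : ℚ → ℝ) (hWq i j₀)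
      push_cast at h3
      exact h3
    rw [Pi.smul_apply, h1, smul_eq_mul, h2, hNR, Matrix.map_apply]
  refine ⟨fun i => W i j₀, fun h => hij (by simpa using congrFun h i₀), ?_⟩
  have hmem : (fun i => (W i j₀ : ℝ)) ∈ P := by
    rw [hcol]
    exact Submodule.smul_mem _ _ (hNall _)
  rw [hP] at hmem
  obtain ⟨c, hc⟩ := (Submodule.mem_span_range_iff_exists_fun ℝ).1 hmem
  refine ⟨c 0, c 1, fun i => ?_⟩
  have := congrFun hc i
  simp [Fin.sum_univ_two] at this
  linarith

end K3Commutant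

/-! ### The companion for case (iii): an isometry rotating an irrational plane with a rational
line acts on it by `±1` -/

section K3PlaneStabilizer

/-- **Two independent lattice vectors in the plane make it rational.** [folklore] -/
theorem k3_isRationalPlane_of_two_latticeVectors {x : K3Index → ℂ} (hx : x ∈ k3PeriodDomain)
    {u w : K3Index → ℤ} (hu : ∃ a b : ℝ, ∀ i, (u i : ℝ) = a * (x i).re + b * (x i).im)
    (hw : ∃ a b : ℝ, ∀ i, (w i : ℝ) = a * (x i).re + b * (x i).im)
    (hind : LinearIndependent ℝ ![(fun i => (u i : ℝ)), (fun i => (w i : ℝ))]) :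
    ∃ (u' w' : K3Index → ℤ) (a b c d : ℝ), ∀ i,
      (x i).re = a * u' i + b * w' i ∧ (x i).im = c * u' i + d * w' i := by
  classical
  set R : K3Index → ℝ := fun i => (x i).re with hR
  set I : K3Index → ℝ := fun i => (x i).im with hI
  set P : Submodule ℝ (K3Index → ℝ) := Submodule.span ℝ (Set.range ![R, I]) with hP
  have hmemP : ∀ {z : K3Index → ℤ}, (∃ a b : ℝ, ∀ i, (z i : ℝ) = a * (x i).re + b * (x i).im) →
      (fun i => (z i : ℝ)) ∈ P := by
    rintro z ⟨a, b, hz⟩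
    have : (fun i => (z i : ℝ)) = a • R + b • I := by funext i; simp [hz i, hR, hI]
    rw [this, hP]
    exact Submodule.add_mem _ (Submodule.smul_mem _ _ (Submodule.subset_span ⟨0, rfl⟩))
      (Submodule.smul_mem _ _ (Submodule.subset_span ⟨1, rfl⟩))
  have hle : Submodule.span ℝ (Set.range ![(fun i => (u i : ℝ)), (fun i => (w i : ℝ))]) ≤ P := by
    refine Submodule.span_le.2 ?_
    rintro _ ⟨k, rfl⟩
    fin_cases k
    · exact hmemP hu
    · exact hmemP hw
  have h2 : finrank ℝ (Submodule.span ℝ (Set.range ![(fun i => (u i : ℝ)), (fun i => (w i : ℝ))])) =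
      2 := by
    rw [finrank_span_eq_card hind]; simp
  have hspan := Submodule.eq_of_le_of_finrank_eq hle (by rw [h2, hP, finrank_k3Plane hx])
  have hRmem : R ∈ Submodule.span ℝ (Set.range ![(fun i => (u i : ℝ)), (fun i => (w i : ℝ))]) := by
    rw [hspan, hP]; exact Submodule.subset_span ⟨0, rfl⟩
  have hImem : I ∈ Submodule.span ℝ (Set.range ![(fun i => (u i : ℝ)), (fun i => (w i : ℝ))]) := by
    rw [hspan, hP]; exact Submodule.subset_span ⟨1, rfl⟩
  obtain ⟨c, hc⟩ := (Submodule.mem_span_range_iff_exists_fun ℝ).1 hRmem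
  obtain ⟨c', hc'⟩ := (Submodule.mem_span_range_iff_exists_fun ℝ).1 hImem
  refine ⟨u, w, c 0, c 1, c' 0, c' 1, fun i => ⟨?_, ?_⟩⟩
  · have := congrFun hc i
    simp [Fin.sum_univ_two, hR] at this
    linarith
  · have := congrFun hc' i
    simp [Fin.sum_univ_two, hI] at this
    linarith

/-- **An integral isometry rotating an irrational plane with a rational line acts on it by `±1`.**
Let `x ∈ D` be in the intermediate case (iii) of `Verbitsky2017_orbitClosure_trichotomy_K3`: its
plane `P_x` contains a non-zero lattice vector `v` but is not rational. If `δ ∈ O(Λ_{K3})` maps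
`P_x` into itself by a ROTATION–scaling of the frame (`δ Re x = c Re x + s Im x`,
`δ Im x = −s Re x + c Im x`; this is the case for `δ` in the Ratner group `SO(P_x^⊥)°·SO(P_x)`),
then `δ` fixes the frame up to sign: `δ Re x = ± Re x`, `δ Im x = ± Im x` (same sign). For then
`δ v ∈ Λ ∩ P_x ⊆ ℝ v` (a second independent lattice vector would make `P_x` rational,
`k3_isRationalPlane_of_two_latticeVectors`) and `(δv.δv) = (v.v) > 0` force `δ v = ± v`, and a
rotation with a fixed (anti-fixed) non-zero vector is `± 1`. Consequently the index-`≤ 2` subgroup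
of `Γ ∩ S` fixing the frame has fixed space `⊇ P_x`, which Borel density and
`k3_isRationalPlane_of_fixedSpace_eq_plane` turn into the rationality of `P_x` — excluding
`S = SO(P_x^⊥)°·SO(P_x)` in case (iii) as well. [folklore] -/
theorem k3_frame_fixed_up_to_sign_of_rotation {x : K3Index → ℂ} (hx : x ∈ k3PeriodDomain)
    {v : K3Index → ℤ} (hv0 : v ≠ 0) (hv : ∃ a b : ℝ, ∀ i, (v i : ℝ) = a * (x i).re + b * (x i).im)
    (hnrat : ¬ ∃ (u w : K3Index → ℤ) (a b c d : ℝ), ∀ i,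
      (x i).re = a * u i + b * w i ∧ (x i).im = c * u i + d * w i)
    {δ : Matrix K3Index K3Index ℤ} (hδ : δ.transpose * k3Gram * δ = k3Gram) {c s : ℝ}
    (hRe : δ.map (Int.cast : ℤ → ℝ) *ᵥ (fun i => (x i).re) =
      c • (fun i => (x i).re) + s • (fun i => (x i).im))
    (hIm : δ.map (Int.cast : ℤ → ℝ) *ᵥ (fun i => (x i).im) =
      (-s) • (fun i => (x i).re) + c • (fun i => (x i).im)) :
    s = 0 ∧ (c = 1 ∨ c = -1) := by
  classical
  set B := Matrix.toBilin' (k3Gram.map (Int.cast : ℤ → ℝ)) with hB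
  set R : K3Index → ℝ := fun i => (x i).re with hR
  set I : K3Index → ℝ := fun i => (x i).im with hI
  obtain ⟨h12, h11, hpos⟩ := (mem_k3PeriodDomain_iff_k3RForm hB x).1 hx
  obtain ⟨a, b, hab⟩ := hv
  have hvR : (fun i => (v i : ℝ)) = a • R + b • I := by funext i; simp [hab i, hR, hI]
  -- `δ v` in coordinates
  have hδv : δ.map (Int.cast : ℤ → ℝ) *ᵥ (fun i => (v i : ℝ)) =
      (a * c - b * s) • R + (a * s + b * c) • I := by
    rw [hvR, Matrix.mulVec_add, Matrix.mulVec_smul, Matrix.mulVec_smul, hRe, hIm]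
    module
  -- `δ v` is a lattice vector in the plane
  have hδvZ : (fun i => ((δ *ᵥ v) i : ℝ)) = δ.map (Int.cast : ℤ → ℝ) *ᵥ (fun i => (v i : ℝ)) := by
    funext i
    simp [Matrix.mulVec, dotProduct, Matrix.map_apply]
  have hδv_in : ∃ a' b' : ℝ, ∀ i, ((δ *ᵥ v) i : ℝ) = a' * (x i).re + b' * (x i).im :=
    ⟨a * c - b * s, a * s + b * c, fun i => by
      have := congrFun (hδvZ.trans hδv) i
      simpa [hR, hI] using this⟩
  have hv_in : ∃ a' b' : ℝ, ∀ i, (v i : ℝ) = a' * (x i).re + b' * (x i).im := ⟨a, b, hab⟩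
  -- hence `δ v ∈ ℝ v` (else `P_x` rational)
  have hdep : ¬ LinearIndependent ℝ ![(fun i => (v i : ℝ)), (fun i => ((δ *ᵥ v) i : ℝ))] :=
    fun hind => hnrat (k3_isRationalPlane_of_two_latticeVectors hx hv_in hδv_in hind)
  -- coordinates: `(a, b) ≠ 0`
  have hab0 : a ≠ 0 ∨ b ≠ 0 := by
    by_contra h
    have ha : a = 0 := by by_contra ha; exact h (Or.inl ha)
    have hb : b = 0 := by by_contra hb; exact h (Or.inr hb)
    apply hv0
    funext i
    have := hab i
    rw [ha, hb, zero_mul, zero_mul, add_zero] at this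
    exact_mod_cast this
  -- independence of `R, I`
  have hRI := k3Plane_linearIndependent hx
  -- from dependence: `δ v = t v`
  obtain ⟨t, ht⟩ : ∃ t : ℝ, (a * c - b * s) = t * a ∧ (a * s + b * c) = t * b := by
    rw [LinearIndependent.pair_iff] at hdep
    -- hdep : ¬ ∀ p q, p • v + q • δv = 0 → p = 0 ∧ q = 0
    by_contra hcon
    apply hdep
    intro p q hpq
    rw [hδvZ, hδv, hvR] at hpq
    have hcomb : (p * a + q * (a * c - b * s)) • R + (p * b + q * (a * s + b * c)) • I = 0 := by
      rw [← hpq]; module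
    have hc1 := (LinearIndependent.pair_iff.1 hRI _ _ hcomb)
    obtain ⟨e1, e2⟩ := hc1
    by_cases hq : q = 0
    · refine ⟨?_, hq⟩
      rw [hq, zero_mul, add_zero] at e1 e2
      rcases hab0 with ha | hb
      · exact (mul_eq_zero.1 e1).resolve_right ha
      · exact (mul_eq_zero.1 e2).resolve_right hb
    · exfalso
      refine hcon ⟨-(p / q), ?_, ?_⟩
      · field_simp
        linarith
      · field_simp
        linarith
  -- isometry: `c² + s² = 1`... via `(δR.δR) = (R.R)`
  have hiso := k3RForm_mulVec_mulVec hB hδ R R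
  rw [hRe, twistorChain_comb2 B k3RForm_comm, h12, ← h11] at hiso
  have hcs : c * c + s * s = 1 := by
    have : (c * c + s * s) * B R R = B R R := by linarith
    have hne := hpos.ne'
    field_simp at this
    nlinarith [this, hpos]
  -- solve `(c − t) a − s b = 0`, `s a + (c − t) b = 0` with `(a,b) ≠ 0`: `c = t`, `s = 0`
  obtain ⟨e1, e2⟩ := ht
  have hs0 : s = 0 := by
    have key : ((c - t) * (c - t) + s * s) * (a * a + b * b) = 0 := by nlinarith [e1, e2]
    have hab2 : a * a + b * b ≠ 0 := by
      rcases hab0 with ha | hb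
      · have := mul_self_pos.2 ha; nlinarith [mul_self_nonneg b]
      · have := mul_self_pos.2 hb; nlinarith [mul_self_nonneg a]
    have h0 : (c - t) * (c - t) + s * s = 0 := (mul_eq_zero.1 key).resolve_right hab2
    nlinarith [mul_self_nonneg (c - t), mul_self_nonneg s]
  refine ⟨hs0, ?_⟩
  rw [hs0, mul_zero, add_zero] at hcs
  have : (c - 1) * (c + 1) = 0 := by linarith
  rcases mul_eq_zero.1 this with h | h
  · exact Or.inl (by linarith)
  · exact Or.inr (by linarith)

end K3PlaneStabilizer

end Literature.Dynamics.Homogeneous
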